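import Mathlib
import HarnessLib
import Literature.NumberTheory.EllipticCurves.ModularCurve
import Literature.NumberTheory.EllipticCurves.ModularCurveManinConstantProofs
import Literature.NumberTheory.EllipticCurves.ModularDegreeMinimal

/-!
# A lattice-optimal parametrisation datum has minimal modular degree

Lead p1 gen 13 (route `ManinLocalTwoThree`; supports the C3 crux item stmt-BirchSwinnertonDyer-22968 — this is STUB 3
`stub_modularDegree_le_of_latticeOptimal` of the planner-of-record's second C3 line `Cruxes/ManinPrimeToThreeAtNine/Lines/ghost_duality.lean`
(imc g23), the «transport, folklore» stub, PROVED; it is route-independent).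

The routes phrase optimality of an `X₀(N)`-datum `D` of `W` in two currencies:

* LATTICE-optimality (the C2/C3 crux binder): `Λ_W = c · Λ_f`, i.e. `∀ z ∈ D.L.lattice, ∃ w ∈ periodLattice D.f, z = D.c * w`
  (together with the structure field `c Λ_f ⊆ Λ_W`);
* DEGREE-minimality (the currency of `abs_maninConstant_eq_one_of_isSemistable`, of the congruence-number files, and of the
  ghost-duality line): `∀ W' (D' : ModularParametrizationData W' N), D'.f = D.f → D.modularDegree ≤ D'.modularDegree`.

THEOREM (`modularDegree_le_of_latticeOptimal`): lattice-optimal ⟹ degree-minimal.  Proof (fibre counting on `deg_spec`, no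
Riemann surfaces): write `I = 2πi∫f`, `φ_D = unif_W (c I)`, `φ_{D'} = unif_{W'} (c' I)`.  For a parameter `u ∈ ℂ` put
`S(u) = {Γ₀(N)τ : φ_D(τ) = unif_W(c u)}` and `S'(u) = {Γ₀(N)τ : φ_{D'}(τ) = unif_{W'}(c' u)}`.  Lattice-optimality and `c ≠ 0`
(`maninConstant_ne_zero_holds`) give `φ_D(τ) = unif_W(c u) ⟺ I(τ) − u ∈ Λ_f`, and `c' Λ_f ⊆ Λ_{W'}` gives `I(τ) − u ∈ Λ_f ⟹
φ_{D'}(τ) = unif_{W'}(c' u)`; so `S(u) ⊆ S'(u)` (`fiber_subset_fiber_of_latticeOptimal`).  The parameters `u` for which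
`#S(u) ≠ deg D` or `#S'(u) ≠ deg D'` form a COUNTABLE set (the exceptional point sets of `deg_spec` are finite, the fibres of
`unif` are cosets of the countable lattice, and `u ↦ c u`, `u ↦ c' u` are injective), while `ℂ` is uncountable; at a good `u`,
`deg D = #S(u) ≤ #S'(u) = deg D'`.

Corollaries: the verbatim stub-3 form (`modularDegree_le_of_latticeOptimal'`), the degree-minimality hypothesis form
(`forall_modularDegree_le_of_latticeOptimal`), equality of degrees of two lattice-optimal data with the same newform
(`modularDegree_eq_of_latticeOptimal`), and `D.modularDegree = minModularDegree W N` (`modularDegree_eq_minModularDegree_of_latticeOptimal`,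
via `IsNewformOf.unique`).

In print: Zagier 1985 §1 / Cremona §2.10 (the optimal curve and its strong parametrisation have the least degree in the
class) — folklore; the tree had both currencies but no bridge.  HONEST FRAMING: elementary and unconditional; it proves
nothing about Manin constants; BSD is not proved by this; C2/C3 OPEN.  beyond-print theorem: NO.
-/

set_option linter.dupNamespace false
set_option autoImplicit false

noncomputable section

open scoped MatrixGroups ModularForm
open CongruenceSubgroup UpperHalfPlane Literature.NumberTheory.EllipticCurves
  Literature.NumberTheory.EllipticCurves.ModularForms

namespace Summit.BirchSwinnertonDyer.BirchSwinnertonDyer.Theorems.ManinLocalTwoThree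

variable {W : WeierstrassCurve ℚ} {N : ℕ} [NeZero N]

/-- The preimage of a countable set of points under the uniformisation `ℂ ↠ E(ℂ)` is countable: each fibre is a coset of the
lattice `Λ_W ≅ ℤ²`. -/
theorem countable_preimage_uniformize (D : ModularParametrizationData W N)
    {B : Set (W.baseChange ℂ).toAffine.Point} (hB : B.Countable) : (D.uniformize ⁻¹' B).Countable := by
  haveI : Countable D.L.lattice := Countable.of_equiv _ D.L.latticeEquivProd.toEquiv.symm
  have hlat : (D.L.lattice : Set ℂ).Countable := Set.countable_coe_iff.mp inferInstance
  refine (hB.biUnion fun P _ =>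
    hlat.image (fun l : ℂ => Function.surjInv D.uniformize_surjective P + l)).mono ?_
  intro z hz
  refine Set.mem_iUnion₂.mpr ⟨D.uniformize z, hz,
    z - Function.surjInv D.uniformize_surjective (D.uniformize z), ?_, by simp⟩
  rw [SetLike.mem_coe, ← D.uniformize_eq_zero_iff, map_sub, Function.surjInv_eq D.uniformize_surjective, sub_self]

/-- The parameters `u ∈ ℂ` at which the fibre of `φ_D` over `unif_W(c u)` does NOT have `deg D` orbits form a countable set
(finitely many exceptional points by `deg_spec`, countable fibres of `unif_W`, and `u ↦ c u` injective as `c ≠ 0`). -/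
theorem countable_setOf_fiberOrbitCount_ne (D : ModularParametrizationData W N) :
    {u : ℂ | D.fiberOrbitCount (D.uniformize ((D.c : ℂ) * u)) ≠ D.modularDegree}.Countable := by
  have hc : (D.c : ℂ) ≠ 0 := by exact_mod_cast D.maninConstant_ne_zero_holds
  exact (countable_preimage_uniformize D D.finite_setOf_fiberOrbitCount_ne.countable).preimage
    (mul_right_injective₀ hc)

/-- **Fibre inclusion.**  If `D` is lattice-optimal (`Λ_W = c Λ_f`) and `D'` is any datum of level `N` with the same newform,
then for every parameter `u` the `Γ₀(N)`-orbits mapped by `φ_D` to `unif_W(c u)` are among those mapped by `φ_{D'}` to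
`unif_{W'}(c' u)`: `φ_D(τ) = unif_W(c u) ⟺ I(τ) − u ∈ Λ_f ⟹ c'(I(τ) − u) ∈ Λ_{W'}`. -/
theorem fiber_subset_fiber_of_latticeOptimal (D : ModularParametrizationData W N)
    (hL : ∀ z ∈ D.L.lattice, ∃ w ∈ periodLattice D.f, z = D.c * w)
    {W' : WeierstrassCurve ℚ} (D' : ModularParametrizationData W' N) (hf : D'.f = D.f) (u : ℂ) :
    {y : Y0 N | ∃ τ : ℍ, Y0.mk N τ = y ∧ D.φ τ = D.uniformize ((D.c : ℂ) * u)} ⊆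
      {y : Y0 N | ∃ τ : ℍ, Y0.mk N τ = y ∧ D'.φ τ = D'.uniformize ((D'.c : ℂ) * u)} := by
  have hc : (D.c : ℂ) ≠ 0 := by exact_mod_cast D.maninConstant_ne_zero_holds
  rintro y ⟨τ, hτ, hφ⟩
  refine ⟨τ, hτ, ?_⟩
  have hmem : (D.c : ℂ) * eichlerIntegral D.f τ - (D.c : ℂ) * u ∈ D.L.lattice := by
    rw [← D.uniformize_eq_zero_iff, map_sub, sub_eq_zero]
    exact hφ
  obtain ⟨w, hw, hcw⟩ := hL _ hmem
  have hwu : eichlerIntegral D.f τ - u = w := by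
    apply mul_left_cancel₀ hc
    rw [mul_sub, hcw]
  have hw' : w ∈ periodLattice D'.f := by
    rw [hf]
    exact hw
  have hmem' : (D'.c : ℂ) * eichlerIntegral D'.f τ - (D'.c : ℂ) * u ∈ D'.L.lattice := by
    rw [← mul_sub, hf, hwu]
    exact D'.smul_periodLattice_le w hw'
  show D'.uniformize ((D'.c : ℂ) * eichlerIntegral D'.f τ) = D'.uniformize ((D'.c : ℂ) * u)
  rw [← sub_eq_zero, ← map_sub, D'.uniformize_eq_zero_iff]
  exact hmem'

/-- **A lattice-optimal datum has minimal modular degree among all data of level `N` with the same newform** (any model `W'`,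
in particular any curve isogenous to `W`): `Λ_W = c Λ_f ⟹ deg φ_D ≤ deg φ_{D'}` whenever `f_{D'} = f_D`.  Fibre counting at a
parameter `u` outside a countable exceptional set (`countable_setOf_fiberOrbitCount_ne`, `not_countable_complex`):
`deg D = #S(u) ≤ #S'(u) = deg D'` by `fiber_subset_fiber_of_latticeOptimal`.  Folklore (Zagier 1985 §1; Cremona §2.10). -/
theorem modularDegree_le_of_latticeOptimal (D : ModularParametrizationData W N)
    (hL : ∀ z ∈ D.L.lattice, ∃ w ∈ periodLattice D.f, z = D.c * w)
    {W' : WeierstrassCurve ℚ} (D' : ModularParametrizationData W' N) (hf : D'.f = D.f) :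
    D.modularDegree ≤ D'.modularDegree := by
  classical
  obtain ⟨u, hu, hu'⟩ : ∃ u : ℂ, D.fiberOrbitCount (D.uniformize ((D.c : ℂ) * u)) = D.modularDegree ∧
      D'.fiberOrbitCount (D'.uniformize ((D'.c : ℂ) * u)) = D'.modularDegree := by
    by_contra h
    refine not_countable_complex
      (((countable_setOf_fiberOrbitCount_ne D).union (countable_setOf_fiberOrbitCount_ne D')).mono fun u _ => ?_)
    by_cases h1 : D.fiberOrbitCount (D.uniformize ((D.c : ℂ) * u)) = D.modularDegree
    · exact Or.inr fun h2 => h ⟨u, h1, h2⟩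
    · exact Or.inl h1
  set S : Set (Y0 N) := {y | ∃ τ : ℍ, Y0.mk N τ = y ∧ D.φ τ = D.uniformize ((D.c : ℂ) * u)} with hS
  set S' : Set (Y0 N) := {y | ∃ τ : ℍ, Y0.mk N τ = y ∧ D'.φ τ = D'.uniformize ((D'.c : ℂ) * u)} with hS'
  have hcard : Nat.card S = D.modularDegree := hu
  have hcard' : Nat.card S' = D'.modularDegree := hu'
  have hfin : S'.Finite := by
    have : Finite S' := Nat.finite_of_card_ne_zero (by rw [hcard']; exact D'.deg_pos.ne')
    exact S'.toFinite
  calc D.modularDegree = Nat.card S := hcard.symm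
    _ ≤ Nat.card S' := Nat.card_mono hfin (fiber_subset_fiber_of_latticeOptimal D hL D' hf u)
    _ = D'.modularDegree := hcard'

/-- The VERBATIM form of stub 3 `stub_modularDegree_le_of_latticeOptimal` of the C3 line `Lines/ghost_duality.lean` (imc g23):
a lattice-optimal datum has minimal modular degree among all data of level `N` with the same newform.  PROVED (the
`[W.IsElliptic]` binders are not used). -/
theorem modularDegree_le_of_latticeOptimal' :
    ∀ (W : WeierstrassCurve ℚ) [W.IsElliptic] {N : ℕ} [NeZero N] (D : ModularParametrizationData W N),
      (∀ z ∈ D.L.lattice, ∃ w ∈ periodLattice D.f, z = D.c * w) →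
      ∀ (W' : WeierstrassCurve ℚ) [W'.IsElliptic] (D' : ModularParametrizationData W' N),
        D'.f = D.f → D.modularDegree ≤ D'.modularDegree :=
  fun _W _ _N _ D hL _W' _ D' hf => modularDegree_le_of_latticeOptimal D hL D' hf

/-- The DEGREE-MINIMALITY hypothesis of `abs_maninConstant_eq_one_of_isSemistable` and of the congruence-number files, produced
from LATTICE-optimality: `∀ W' [W'.IsElliptic] (D' : ModularParametrizationData W' N), D'.f = D.f → deg D ≤ deg D'`. -/
theorem forall_modularDegree_le_of_latticeOptimal (D : ModularParametrizationData W N)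
    (hL : ∀ z ∈ D.L.lattice, ∃ w ∈ periodLattice D.f, z = D.c * w) :
    ∀ (W' : WeierstrassCurve ℚ) [W'.IsElliptic] (D' : ModularParametrizationData W' N),
      D'.f = D.f → D.modularDegree ≤ D'.modularDegree :=
  fun _W' _ D' hf => modularDegree_le_of_latticeOptimal D hL D' hf

/-- Two lattice-optimal data of the same level with the same newform (e.g. the optimal data of two models of the optimal curve)
have the same modular degree. -/
theorem modularDegree_eq_of_latticeOptimal (D : ModularParametrizationData W N)
    (hL : ∀ z ∈ D.L.lattice, ∃ w ∈ periodLattice D.f, z = D.c * w)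
    {W' : WeierstrassCurve ℚ} (D' : ModularParametrizationData W' N)
    (hL' : ∀ z ∈ D'.L.lattice, ∃ w ∈ periodLattice D'.f, z = D'.c * w) (hf : D'.f = D.f) :
    D.modularDegree = D'.modularDegree :=
  le_antisymm (modularDegree_le_of_latticeOptimal D hL D' hf) (modularDegree_le_of_latticeOptimal D' hL' D hf.symm)

/-- A lattice-optimal datum realises the minimal modular degree `minModularDegree W N` of its own model (all data of `W` at
level `N` have the same newform, `IsNewformOf.unique`). -/
theorem modularDegree_eq_minModularDegree_of_latticeOptimal (D : ModularParametrizationData W N)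
    (hL : ∀ z ∈ D.L.lattice, ∃ w ∈ periodLattice D.f, z = D.c * w) :
    D.modularDegree = minModularDegree W N :=
  (modularDegree_eq_minModularDegree_iff D).mpr fun D' =>
    modularDegree_le_of_latticeOptimal D hL D' (D'.isNewformOf.unique D.isNewformOf)

end Summit.BirchSwinnertonDyer.BirchSwinnertonDyer.Theorems.ManinLocalTwoThree

end
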